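import Mathlib
import Summits.Ventures.PercRepro2.MixChordOStarSupport

/-!
# THE `o`–ROOT STAR AT THE ROOT `a₂` (blind cell PercRepro2, night-1 g24; proofs/NIGHT1-G24.md §6)

The root swap of MixChordOStarMain.lean / MixChordOStarSupport.lean: for `a₃` with exactly the two edges
`g = {a₃, o}` and `e = {a₃, a₂}` (up to zero-weight edges at `a₃`), the `o`-class `D`-chord along the
`o`-edge `f = {o, a₂}` (`dChord_o_edge₂_of_o_root_star`, `_support`), (HCOV) (`HCov_o_root_star₂`,
`_support`) and the chain's row (`dz2Chord_o_edge₂_of_o_root_star`, `_support`), by g22's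
`nMixChord_normD_root_swap` and typer-1's `HCov_swap`.  Own code; standard axioms.
-/

namespace Summit.Ventures.PercRepro2

open UnionCluster CovForm

namespace Mix

namespace OStar

section Mirror

variable {V : Type*} {E : Type*} [Fintype E] [DecidableEq E] [Fintype V] [DecidableEq V] {R : Type*}
  [Field R] [LinearOrder R] [IsStrictOrderedRing R]

variable (p : E → R) (ends : E → Sym2 V) {o a₁ a₂ a₃ : V} (b : V) {f g e : E}

/-- **The `o`–root star at the root `a₂`: the `D`-chord along `{o, a₂}`** (the literal star). -/
theorem dChord_o_edge₂_of_o_root_star (hp : IsProbVec p) (hf : ends f = s(o, a₂))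
    (hg : ends g = s(a₃, o)) (he : ends e = s(a₃, a₂)) (hstar : ∀ e', a₃ ∈ ends e' → e' = g ∨ e' = e)
    (h13 : a₁ ≠ a₃) (h23 : a₂ ≠ a₃) (ho2 : o ≠ a₂) (ho3 : o ≠ a₃) (hb3 : b ≠ a₃) :
    NMixChord (normD ends a₁ a₂ a₃) p ends o a₁ a₂ a₃ b f :=
  (nMixChord_normD_root_swap p ends b o a₁ a₂ a₃ f).1
    (dChord_o_edge_of_o_root_star p ends b hp hf hg he hstar h23 h13 ho2 ho3 hb3)

/-- **(HCOV) on the `o`–root star at the root `a₂`** (the literal star). -/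
theorem HCov_o_root_star₂ (hp : IsProbVec p) (hg : ends g = s(a₃, o)) (he : ends e = s(a₃, a₂))
    (hstar : ∀ e', a₃ ∈ ends e' → e' = g ∨ e' = e) (h13 : a₁ ≠ a₃) (h23 : a₂ ≠ a₃) (ho2 : o ≠ a₂)
    (ho3 : o ≠ a₃) (hb3 : b ≠ a₃) : HCov p ends o a₁ a₂ a₃ b :=
  (HCov_swap p ends o a₁ a₂ a₃ b).1 (HCov_o_root_star p ends b hp hg he hstar h23 h13 ho2 ho3 hb3)

/-- **The chain's row on the `o`–root star at the root `a₂`** (the literal star). -/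
theorem dz2Chord_o_edge₂_of_o_root_star (hp : IsProbVec p) (hf : ends f = s(o, a₂))
    (hg : ends g = s(a₃, o)) (he : ends e = s(a₃, a₂)) (hstar : ∀ e', a₃ ∈ ends e' → e' = g ∨ e' = e)
    (h13 : a₁ ≠ a₃) (h23 : a₂ ≠ a₃) (ho2 : o ≠ a₂) (ho3 : o ≠ a₃) (hb3 : b ≠ a₃) :
    NMixChord (normDZ2 ends a₁ a₂ a₃) p ends o a₁ a₂ a₃ b f :=
  nMixChord_DZ2_of_D hp (dChord_o_edge₂_of_o_root_star p ends b hp hf hg he hstar h13 h23 ho2 ho3 hb3)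
    (HCov_o_root_star₂ (Function.update p f 0) ends b (hp.update f le_rfl zero_le_one) hg he hstar h13 h23
      ho2 ho3 hb3)

/-- **The `o`–root star at the root `a₂` in the support graph: the `D`-chord along `{o, a₂}`.** -/
theorem dChord_o_edge₂_of_o_root_star_support (hp : IsProbVec p) (hf : ends f = s(o, a₂))
    (hg : ends g = s(a₃, o)) (he : ends e = s(a₃, a₂))
    (hstar : ∀ e', a₃ ∈ ends e' → e' ≠ g → e' ≠ e → p e' = 0)
    (h13 : a₁ ≠ a₃) (h23 : a₂ ≠ a₃) (ho2 : o ≠ a₂) (ho3 : o ≠ a₃) (hb3 : b ≠ a₃) :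
    NMixChord (normD ends a₁ a₂ a₃) p ends o a₁ a₂ a₃ b f :=
  (nMixChord_normD_root_swap p ends b o a₁ a₂ a₃ f).1
    (dChord_o_edge_of_o_root_star_support p ends b hp hf hg he hstar h23 h13 ho2 ho3 hb3)

/-- **(HCOV) on the `o`–root star at the root `a₂` in the support graph.** -/
theorem HCov_o_root_star₂_support (hp : IsProbVec p) (hg : ends g = s(a₃, o)) (he : ends e = s(a₃, a₂))
    (hstar : ∀ e', a₃ ∈ ends e' → e' ≠ g → e' ≠ e → p e' = 0) (h13 : a₁ ≠ a₃) (h23 : a₂ ≠ a₃)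
    (ho2 : o ≠ a₂) (ho3 : o ≠ a₃) (hb3 : b ≠ a₃) : HCov p ends o a₁ a₂ a₃ b :=
  (HCov_swap p ends o a₁ a₂ a₃ b).1
    (HCov_o_root_star_support p ends b hp hg he hstar h23 h13 ho2 ho3 hb3)

/-- **The chain's row on the `o`–root star at the root `a₂` in the support graph.** -/
theorem dz2Chord_o_edge₂_of_o_root_star_support (hp : IsProbVec p) (hf : ends f = s(o, a₂))
    (hg : ends g = s(a₃, o)) (he : ends e = s(a₃, a₂))
    (hstar : ∀ e', a₃ ∈ ends e' → e' ≠ g → e' ≠ e → p e' = 0)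
    (h13 : a₁ ≠ a₃) (h23 : a₂ ≠ a₃) (ho2 : o ≠ a₂) (ho3 : o ≠ a₃) (hb3 : b ≠ a₃) :
    NMixChord (normDZ2 ends a₁ a₂ a₃) p ends o a₁ a₂ a₃ b f :=
  nMixChord_DZ2_of_D hp
    (dChord_o_edge₂_of_o_root_star_support p ends b hp hf hg he hstar h13 h23 ho2 ho3 hb3)
    (HCov_o_root_star₂_support (Function.update p f 0) ends b (hp.update f le_rfl zero_le_one) hg he
      (fun e' h3 hg' he' => by
        rw [Function.update_of_ne]
        · exact hstar e' h3 hg' he'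
        · intro hef
          rw [hef, hf, Sym2.mem_iff] at h3
          rcases h3 with h | h
          · exact ho3 h.symm
          · exact h23 h.symm)
      h13 h23 ho2 ho3 hb3)

end Mirror

end OStar

end Mix

end Summit.Ventures.PercRepro2
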